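import Summits.ABC.IUTFork.Repair.CandInternal2RealLabelsLicenceGenuineK
import Summits.ABC.IUTFork.Cor312ProvKRamified
import Literature.IUT.LogVolume.LogRadiusClosedForm
import HarnessLib

/-!
# R-H ROUND 1 (D-0079 «local-height condition I06⋆», D-0107), candidate row 9 `label-cut-j3`: the deciding declaration
# `HStar` — «I06⋆ cells at the labels `j ≤ 3` only» — at the genuine `K`-level datum `Cor312Prov.pilotDataOfK D K`, with its
# column-vocabulary deciders (k1) in INTEGER currency

Bookkeeping file of the abc-iut cell, rung LADDER-ABC:A2.RESCUE.H (plan/rescue/R-H/START-HERE.md v1.3, RH-CANDIDATES.tsv row 9; seat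
abc-iut-rh-typ-9 = TYPER of pair 9). TAKES NO SIDE on [IUTchIII] Cor. 3.12 or on any author; the candidate is a HYPOTHESIS SHAPE (claim-tagged
`def … : Prop`), never a Literature fact; typed ≠ proved; instantiated ≠ endorsed; a k1 «fail» is a verdict about OUR typed reading on OUR
table of record, nothing about print. TWO bookkeeping definitions over the genuine bed (`StarBelow`, the C1 constant label cut of which row 9
is the instance `j₀ = 3`, and `HStar := StarBelow 3`) and TWO integer door predicates (`PosDoor`, `NegDoor`, the I06STAR-COLUMNS cell recipe in
`w`-units); everything else PROOF-ONLY, consumed BY NAME.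

ROW 9 (verbatim, RH-CANDIDATES.tsv v1 f7773e15cd7f6906 / v1.3, writer abc-iut-rh-lead g0): slug `label-cut-j3`; informal statement «I06* cells
at labels j<=3 only: h(w,3) = 8H/(2l) <= kappa_minus(w)»; stratum/scope «all bad places»; cut class «C1 / G2»; k1 recipe «cell(j=3) column per
place»; lead prediction «16/256 HEX (label_profile j_pos_upto=3 rows: k=1 large e_w); DH11a1: j=3 OPEN»; k2 door «as row 1 (licence_of_starOn +
off-window input; budget door)»; k4 «vs I06*: those 16 rows; vs S_H: distinct»; expected «KILL k1 on HEX-all (6%); documents where the label cut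
breaks (j0=2 -> 3 frontier: e_w >= ? at k=1)».

WHAT IS TYPED (namespace `Summit.ABC.IUTFork.Repair.RH.LabelCutJ3`), at the genuine `K`-level pilot datum `pilotDataOfK D K` of an arbitrary
collection of initial Θ-data `D : InitialThetaData F K Fbar E l Pb` ([IUTchI] Def. 3.1), bad places `= (pilotDataOfK D K).S`, packets indexed by
rational primes `pp`, places `w` in the fibre over `pp`, completions `K_w = kOf (pilotDataOfK D K) pp w`, REAL log-shell `ℐ_{K_w} = (p*)⁻¹·log_p(𝒪^×)`
(`logShell (PadicLogOnUnits.ofUnitLog p K_w)`, [AbsTopIII] Def. 5.4 (iii)), a q-idele `tq` (for the k1 deciders: REALISING the q-pilot divisor,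
abc-iut-w5-d236's binder `htq`, Dupuy–Hilado (3.4); [IUTchI] Ex. 3.2 (iv) makes `P_q(w) = P_w ∈ ℕ`, `Cor312Prov.exists_nat_qPilot_pilotDataOfK`):
* `StarBelow D tq j₀` — the C1 LABEL CUT in abc-iut-rp-d2's REAL one-element I06⋆ currency: «`t_{q,w} ∈ t_{q,w}^{j²}·ℐ_{K_w}` at every bad place `w`
  and every label `j = i+1 ≤ j₀`» — EXACTLY the `hstar` binder of abc-iut-w5-d068's `CandInternal2RealLabelsLicenceGenuineK.licence_settingPrVolSharp_
  pilotDataOfK_of_realStar_tame` restricted to `i+1 ≤ j₀`, i.e. the data-level reading of the `hbelow` input of abc-iut-rp-h3's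
  `CandInternal11GapLabelCut.licence_of_starBelow … (fun _ ↦ j₀)` (p455703); row 1 is `j₀ = 2`, row 9 is `j₀ = 3`.
* **`HStar D tq := StarBelow D tq 3`** — THE DECIDING DECLARATION `H⋆_9` of row 9.
* §1 structure: `starBelow_anti` (antitone in the cut), `starBelow_of_realStar` (full real I06⋆ ⟹ every cut), `realStar_of_starBelow` (a cut
  `≥ l⋆` IS full real I06⋆), `starBelow_two_of_hStar` (H⋆_9 ⟹ row 1's H⋆_1 shape), `hStar_iff_realStar_of_l_le` (`l ≤ 8`: H⋆_9 = I06⋆).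
* §2 THE k1 DOORS IN INTEGER `w`-CURRENCY (START-HERE §2 units identity: demand `(j²−1)·m_q(w)`, `m_q = P_w`, capacity⁻ `= e_w·c − ⌈e_w/(p−2)⌉`,
  capacity⁺ `= e_w·c + e_w·⌊log_p(p·e_w/(p−1))⌋ − 1`; `c = 1` at genuine bad places, `p` odd by Def. 3.1 (b)): `PosDoor p e P j :=
  j²·P + ⌈e/(p−2)⌉ ≤ e + P` (⟺ `slack_minus(w,j) ≥ 0` ⟺ `h(w,j) ≤ κ⁻(w)`) and `NegDoor p e P j := e·(Nat.log p (e/(p−1)) + 2) + P ≤ j²·P`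
  (⟺ `h(w,j) > κ⁺(w)` on the non-tame rows `e ≥ p−1`; sufficient for NEG at every `e`); `posDoor_anti` / `negDoor_mono` (monotone in `j`).
* §3 GENUINE DECIDERS (realising `tq`): `norm_tq_eq_rpow` (`‖t_{q,w}‖ = p^{−P_w/e_w}`), `cell_of_le` / `not_cell_of_lt` (the real window of
  abc-iut-rp-d2's `CandInternal2RealLabels` in height `h = P_w/e_w`), **`cell_of_posDoor`** / **`not_cell_of_negDoor`** (integer doors via abc-iut-rp-x2's
  `Literature.IUT.LogVolume.logRadiusA_eq_ceilDiv` / `logRadiusB_eq_natLog`), `cell_iff_of_tame` (tame closed form BY NAME), and at the level of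
  H⋆_9: **`hStar_of_posDoor`** (POS door at `j = 3` at every bad place ⟹ H⋆_9), **`not_hStar_of_negDoor`** (`l ≥ 7` and the NEG door at `j = 3` at
  ONE bad place ⟹ ¬H⋆_9), `hStar_chosen_of_posDoor` (the same for the CHOSEN realising q-idele, idele-hypothesis-free).
* §4 k1 ROWS BY `decide` (column vocabulary `(p, e_w, P_w = e_w·H/(2l), j)`): the HEX frontier `k = 1` POS / `k ≥ 2` OPEN at `j = 3`
  (`(k,l,e_w) = (1,11,11)` TIGHT: `8·1 + 3 = 11`), DH11a1 OPEN, DH67a1 POS, X75 POS / X72 NEG at their top label `2`; `posDoor_three_iff`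
  (`PosDoor p e P 3 ⟺ 8·P + ⌈e/(p−2)⌉ ≤ e`, i.e. «`4H ≤ l·κ⁻(w)`»: the label cut `j ≤ 3` survives exactly while `ord_p(q_E) ≤ l·κ⁻(w)/4`).

k1 OF THIS SEAT (exact rationals, two engines, staging/RH/abc-iut-rh-typ-9/k1_labelcut.py; table I06STAR-COLUMNS v3 0be3842e1fecb6e1 whose cols 1–30
on the 1377 v1 rows = v1 2e4c48fd4267a5a7): datum groups (conjunction over bad places, OPEN against) HEX-lamSeven 16/256 (= the 16 `k = 1` groups;
0/16 at every `k ≥ 2`), HEX-strip 24/272, concrete 2/4, DH 1/2, pooled v1 42/532 = 7.9 %; ceiling 149/256, not ceiling-tight; A6 slice `k₀ = 1`.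
VERDICT WORD expected for ROUND1.tsv: KILL(k1) on HEX-all (+ WINDOW-LOCATOR(HEX: k ≤ 1) per A6). HONEST SCOPE: the deep cells between the two doors
stay SHAPE/ELEMENT-OPEN here (no claim); nothing about hulls, volumes or the Statement (the k2 side is abc-iut-rp-m4's / rp-h1's by name).
[cite: Mochizuki2012, IUTchI Def. 3.1 (b),(c) pp. 61–62, Ex. 3.2 (iv) p. 71; IUTchIV Prop. 1.2 (i) p. 10] [cite: MochizukiAbsTopIII2015, Def 5.4 (iii) p. 126]
[cite: DupuyHilado2025, §3.3, §3.4] [claim: Mochizuki2012, status: disputed] for every IUT locution. Axioms: standard.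
-/

noncomputable section

open Set Metric Function NumberField IsDedekindDomain
open scoped Pointwise

namespace Summit.ABC.IUTFork.Repair.RH.LabelCutJ3

open Literature.AnabelianGeometry.AbsoluteAnabelian Literature.IUT.LogThetaLattice Literature.IUT.LogVolume
  Literature.IUT.HodgeTheaters Literature.NumberTheory.NumberFields Literature.NumberTheory.GaloisRepresentations.Ultrametric
open Summit.ABC.IUTFork.Thm311 Summit.ABC.IUTFork.Thm311.Real Summit.ABC.IUTFork.Cor312 Summit.ABC.IUTFork.Cor312.Setting
  Summit.ABC.IUTFork.Cor312Vol Summit.ABC.IUTFork.Cor312Prov Summit.ABC.IUTFork.Repair.CandInternal2Real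
  Summit.ABC.IUTFork.Repair.CandInternal2RealLabels

/-! ## §2 (stated first). The two integer doors of the I06STAR-COLUMNS cell recipe, `w`-units -/

section Doors

/-- **POS DOOR in integer `w`-currency**: `PosDoor p e P j :⟺ j²·P + ⌈e/(p−2)⌉ ≤ e + P` (`⌈e/(p−2)⌉ = (e + p − 3)/(p − 2)` in `ℕ`), i.e.
`(j²−1)·P ≤ e − ⌈e/(p−2)⌉ = e·(c − a_e)` for odd `p` (`c = 1`): the table's `slack_minus(w,j) ≥ 0` / «`h(w,j) ≤ κ⁻(w)`» with `P = m_q(w) = e_w·H/(2l)`.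
[folklore] -/
@[folklore]
def PosDoor (p e P j : ℕ) : Prop := j ^ 2 * P + (e + (p - 3)) / (p - 2) ≤ e + P

/-- **NEG DOOR in integer `w`-currency**: `NegDoor p e P j :⟺ e·(Nat.log p (e/(p−1)) + 2) + P ≤ j²·P`, i.e. `e·(b_e + c) < (j²−1)·P` for odd `p`
on the rows `e ≥ p − 1` (`e·(b_e + 1) = e·(⌊log_p(e/(p−1))⌋ + 2) − 1`): the table's «`h(w,j) > κ⁺(w)`»; on tame rows `e ≤ p − 2` it is still
sufficient for NEG (there `e·(b_e + 1) = e − 1`). [folklore] -/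
@[folklore]
def NegDoor (p e P j : ℕ) : Prop := e * (Nat.log p (e / (p - 1)) + 2) + P ≤ j ^ 2 * P

/-- The POS door is ANTITONE in the label: `j ≤ j'`, door at `j'` ⟹ door at `j`. [folklore] -/
theorem posDoor_anti {p e P j j' : ℕ} (hjj : j ≤ j') (h : PosDoor p e P j') : PosDoor p e P j := by
  unfold PosDoor at h ⊢
  have : j ^ 2 * P ≤ j' ^ 2 * P := Nat.mul_le_mul_right P (Nat.pow_le_pow_left hjj 2)
  omega

/-- The NEG door is MONOTONE in the label: `j ≤ j'`, door at `j` ⟹ door at `j'`. [folklore] -/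
theorem negDoor_mono {p e P j j' : ℕ} (hjj : j ≤ j') (h : NegDoor p e P j) : NegDoor p e P j' := by
  unfold NegDoor at h ⊢
  have : j ^ 2 * P ≤ j' ^ 2 * P := Nat.mul_le_mul_right P (Nat.pow_le_pow_left hjj 2)
  omega

/-- **The row-9 door in closed form**: `PosDoor p e P 3 ⟺ 8·P + ⌈e/(p−2)⌉ ≤ e` — in column vocabulary `h(w,3) = 8H/(2l) = 4H/l ≤ κ⁻(w)`, i.e.
the label cut `j ≤ 3` survives exactly while `H = ord_p(q_E) ≤ l·κ⁻(w)/4`. [folklore] -/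
theorem posDoor_three_iff (p e P : ℕ) : PosDoor p e P 3 ↔ 8 * P + (e + (p - 3)) / (p - 2) ≤ e := by
  unfold PosDoor
  omega

/-- The two doors EXCLUDE each other (`e ≥ 1`): no cell is both POS and NEG. [folklore] -/
theorem not_negDoor_of_posDoor {p e P j : ℕ} (he : 1 ≤ e) (h : PosDoor p e P j) : ¬ NegDoor p e P j := by
  unfold PosDoor at h; unfold NegDoor
  have h0 : 0 ≤ (e + (p - 3)) / (p - 2) := Nat.zero_le _
  have h1 : e * 2 ≤ e * (Nat.log p (e / (p - 1)) + 2) := Nat.mul_le_mul_left e (by omega)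
  omega

end Doors

/-! ## §1. The label cut at the genuine bed, and row 9's `H⋆` -/

section Genuine

variable {F K Fbar : Type} [Field F] [NumberField F] [Field K] [NumberField K] [Algebra F K] [Field Fbar]
  [Algebra F Fbar] [Algebra K Fbar] {E : WeierstrassCurve F} [E.IsElliptic] {l : ℕ} {Pb : BadPlacePredicates K}
  (D : InitialThetaData F K Fbar E l Pb)
  (tq : ∀ (pp : Nat.Primes) (x : (thetaIndex (pilotDataOfK D K)).Fibre (.inr pp)),
    haveI : Fact (pp : ℕ).Prime := ⟨pp.2⟩; kOf (pilotDataOfK D K) pp.1 x)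

/-- **THE C1 LABEL CUT `j ≤ j₀` AT THE GENUINE BED, real I06⋆ currency**: at every BAD place `w ∣ p` of `pilotDataOfK D K` and every label
`j = i+1 ∈ 𝔽_l^⋇` with `j ≤ j₀`, the q-idele lies in the `j²`-power orbit of the real log-shell: `t_{q,w} ∈ t_{q,w}^{j²} · ℐ_{K_w}`. No claim at the
labels `j > j₀`. (The `hstar` binder of `licence_settingPrVolSharp_pilotDataOfK_of_realStar_tame` restricted to `i+1 ≤ j₀`.) [R-H candidate family
C1, hypothesis shape — not a fact] [claim: Mochizuki2012, status: disputed] [cite: MochizukiAbsTopIII2015, Def 5.4 (iii) p. 126] -/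
@[claim "Mochizuki2012" "disputed"]
def StarBelow (j₀ : ℕ) : Prop :=
  ∀ (pp : Nat.Primes) (i : Fin (pilotDataOfK D K).lstar) (w : (thetaIndex (pilotDataOfK D K)).Fibre (.inr pp)),
    haveI : Fact (pp : ℕ).Prime := ⟨pp.2⟩
    placeOf (pilotDataOfK D K) pp.1 w ∈ (pilotDataOfK D K).S → (i : ℕ) + 1 ≤ j₀ →
      tq pp w ∈ tq pp w ^ (((i : ℕ) + 1) ^ 2) • logShell (PadicLogOnUnits.ofUnitLog (pp : ℕ) (kOf (pilotDataOfK D K) pp.1 w))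

/-- **ROW 9 `label-cut-j3`, THE DECIDING DECLARATION `H⋆_9`**: «I06⋆ cells at labels `j ≤ 3` only» at the genuine `K`-level datum — the real
I06⋆ cell `t_{q,w} ∈ t_{q,w}^{j²} · ℐ_{K_w}` at every bad place `w` for `j ∈ {1, 2, 3}` (∩ `𝔽_l^⋇`), nothing demanded at `j ≥ 4`. Its POS door per
place is the row's «`h(w,3) = 8H/(2l) ≤ kappa_minus(w)`» (`hStar_of_posDoor`). [R-H candidate, hypothesis — not a fact]
[claim: Mochizuki2012, status: disputed] [cite: MochizukiAbsTopIII2015, Def 5.4 (iii) p. 126] -/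
@[claim "Mochizuki2012" "disputed"]
def HStar : Prop := StarBelow D tq 3

/-- `l⋆ = (l − 1)/2` at the genuine datum. [cite: Mochizuki2012, IUTchI Def. 3.1 p. 61] -/
theorem lstar_eq : (pilotDataOfK D K).lstar = (l - 1) / 2 := rfl

/-- **The cut is ANTITONE**: `j₀ ≤ j₀'` and the cut at `j₀'` ⟹ the cut at `j₀` (abc-iut-rp-h3's `starBelow_anti`, data level). [folklore] -/
theorem starBelow_anti {j₀ j₀' : ℕ} (hle : j₀ ≤ j₀') (h : StarBelow D tq j₀') : StarBelow D tq j₀ :=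
  fun pp i w hw hi => h pp i w hw (hi.trans hle)

/-- **FULL real I06⋆ ⟹ EVERY CUT** (the `hstar` binder of the tame join gives `StarBelow j₀` for all `j₀`). [claim: Mochizuki2012, status: disputed] -/
theorem starBelow_of_realStar (j₀ : ℕ)
    (hstar : ∀ (pp : Nat.Primes) (i : Fin (pilotDataOfK D K).lstar) (w : (thetaIndex (pilotDataOfK D K)).Fibre (.inr pp)),
      haveI : Fact (pp : ℕ).Prime := ⟨pp.2⟩
      placeOf (pilotDataOfK D K) pp.1 w ∈ (pilotDataOfK D K).S →
        tq pp w ∈ tq pp w ^ (((i : ℕ) + 1) ^ 2) • logShell (PadicLogOnUnits.ofUnitLog (pp : ℕ) (kOf (pilotDataOfK D K) pp.1 w))) :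
    StarBelow D tq j₀ :=
  fun pp i w hw _ => hstar pp i w hw

/-- **A CUT AT OR ABOVE `l⋆` IS FULL real I06⋆** (abc-iut-rp-h3's `starBelow_iff_star_of_lstar_le`, data level). [claim: Mochizuki2012, status: disputed] -/
theorem realStar_of_starBelow {j₀ : ℕ} (htop : (pilotDataOfK D K).lstar ≤ j₀) (h : StarBelow D tq j₀) :
    ∀ (pp : Nat.Primes) (i : Fin (pilotDataOfK D K).lstar) (w : (thetaIndex (pilotDataOfK D K)).Fibre (.inr pp)),
      haveI : Fact (pp : ℕ).Prime := ⟨pp.2⟩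
      placeOf (pilotDataOfK D K) pp.1 w ∈ (pilotDataOfK D K).S →
        tq pp w ∈ tq pp w ^ (((i : ℕ) + 1) ^ 2) • logShell (PadicLogOnUnits.ofUnitLog (pp : ℕ) (kOf (pilotDataOfK D K) pp.1 w)) :=
  fun pp i w hw => h pp i w hw (by have := i.2; omega)

/-- Full real I06⋆ ⟹ `H⋆_9` (row 9 is WEAKER than I06⋆ as typed; the k4 separating cells are the table's, e.g. HEX:1:11@p7.j5).
[claim: Mochizuki2012, status: disputed] -/
theorem hStar_of_realStar
    (hstar : ∀ (pp : Nat.Primes) (i : Fin (pilotDataOfK D K).lstar) (w : (thetaIndex (pilotDataOfK D K)).Fibre (.inr pp)),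
      haveI : Fact (pp : ℕ).Prime := ⟨pp.2⟩
      placeOf (pilotDataOfK D K) pp.1 w ∈ (pilotDataOfK D K).S →
        tq pp w ∈ tq pp w ^ (((i : ℕ) + 1) ^ 2) • logShell (PadicLogOnUnits.ofUnitLog (pp : ℕ) (kOf (pilotDataOfK D K) pp.1 w))) :
    HStar D tq :=
  starBelow_of_realStar D tq 3 hstar

/-- `H⋆_9` ⟹ row 1's shape `H⋆_1 = StarBelow 2` (the cut is antitone). [claim: Mochizuki2012, status: disputed] -/
theorem starBelow_two_of_hStar (h : HStar D tq) : StarBelow D tq 2 :=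
  starBelow_anti D tq (by norm_num) h

/-- **For `l ≤ 8` (admissible `l ∈ {5, 7}`: `l⋆ ≤ 3`) `H⋆_9` IS full real I06⋆** — on the `l = 5, 7` calibration strips row 9 asks exactly what
I06⋆ asks. [claim: Mochizuki2012, status: disputed] -/
theorem hStar_iff_realStar_of_l_le (hl : l ≤ 8) :
    HStar D tq ↔
      ∀ (pp : Nat.Primes) (i : Fin (pilotDataOfK D K).lstar) (w : (thetaIndex (pilotDataOfK D K)).Fibre (.inr pp)),
        haveI : Fact (pp : ℕ).Prime := ⟨pp.2⟩
        placeOf (pilotDataOfK D K) pp.1 w ∈ (pilotDataOfK D K).S →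
          tq pp w ∈ tq pp w ^ (((i : ℕ) + 1) ^ 2) • logShell (PadicLogOnUnits.ofUnitLog (pp : ℕ) (kOf (pilotDataOfK D K) pp.1 w)) :=
  ⟨fun h => realStar_of_starBelow D tq (by rw [lstar_eq]; omega) h, hStar_of_realStar D tq⟩

/-! ## §3. Genuine deciders for a REALISING q-idele: the doors decide the cells, hence `H⋆_9` -/

variable (htq0 : ∀ pp x, tq pp x ≠ 0)
  (htq : ∀ (pp : Nat.Primes) (x : (thetaIndex (pilotDataOfK D K)).Fibre (.inr pp)),
    haveI : Fact (pp : ℕ).Prime := ⟨pp.2⟩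
    Real.log ‖tq pp x‖ = -((pilotDataOfK D K).qPilot (placeOf (pilotDataOfK D K) pp.1 x)) *
      logNorm K (placeOf (pilotDataOfK D K) pp.1 x) / localDegree K (placeOf (pilotDataOfK D K) pp.1 x))

include htq0 htq in
/-- **`‖t_{q,w}‖ = p^{−P_w/e_w}`** in the rescaled completion `K_w`, for a realising q-idele with `P_q(w) = P_w ∈ ℕ` and
`e_w = e(K_w/ℚ_p) = e(w|p)` (abc-iut-w5-d236's `norm_qIdele_eq_rpow_of_realises`, abc-iut-S1's `absRamificationIdx_rescaledCompletion`).
[cite: DupuyHilado2025, §3.4] -/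
theorem norm_tq_eq_rpow (pp : Nat.Primes) (w : (thetaIndex (pilotDataOfK D K)).Fibre (.inr pp)) {P : ℕ}
    (hP : haveI : Fact (pp : ℕ).Prime := ⟨pp.2⟩; (pilotDataOfK D K).qPilot (placeOf (pilotDataOfK D K) pp.1 w) = P) :
    haveI : Fact (pp : ℕ).Prime := ⟨pp.2⟩
    ‖tq pp w‖ = ((pp : ℕ) : ℝ) ^ (-((P : ℝ) / (absRamificationIdx (pp : ℕ) (kOf (pilotDataOfK D K) pp.1 w) : ℝ))) := by
  haveI hF : Fact (pp : ℕ).Prime := ⟨pp.2⟩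
  have heK : absRamificationIdx (pp : ℕ) (kOf (pilotDataOfK D K) pp.1 w) = (placeOf (pilotDataOfK D K) pp.1 w).asIdeal.ramificationIdx ℤ :=
    absRamificationIdx_rescaledCompletion K (pp : ℕ) (placeOf (pilotDataOfK D K) pp.1 w) (natCast_mem_placeOf (pilotDataOfK D K) pp.1 w)
  have hramF : (ramIdx K (placeOf (pilotDataOfK D K) pp.1 w) : ℝ) = (absRamificationIdx (pp : ℕ) (kOf (pilotDataOfK D K) pp.1 w) : ℝ) := by
    rw [ramIdx_eq K (placeOf (pilotDataOfK D K) pp.1 w), heK]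
  rw [norm_qIdele_eq_rpow_of_realises (pilotDataOfK D K) tq htq0 htq pp w, hP, hramF, neg_div]

include htq0 htq in
/-- **POS CELL, real height form** (any stratum): `((j²) − 1)·P_w ≤ e_w·(c − a_{e_w})` ⟹ `t_{q,w} ∈ t_{q,w}^{j²} · ℐ_{K_w}` (abc-iut-rp-d2's
`mem_pow_smul_logShell_of_height_le` at `h = P_w/e_w`). [cite: MochizukiAbsTopIII2015, Def 5.4 (iii) p. 126] [claim: Mochizuki2012, status: disputed] -/
theorem cell_of_le (pp : Nat.Primes) (w : (thetaIndex (pilotDataOfK D K)).Fibre (.inr pp)) {P : ℕ}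
    (hP : haveI : Fact (pp : ℕ).Prime := ⟨pp.2⟩; (pilotDataOfK D K).qPilot (placeOf (pilotDataOfK D K) pp.1 w) = P) {j : ℕ}
    (hle : haveI : Fact (pp : ℕ).Prime := ⟨pp.2⟩
      (((j ^ 2 : ℕ) : ℝ) - 1) * (P : ℝ) ≤
        (absRamificationIdx (pp : ℕ) (kOf (pilotDataOfK D K) pp.1 w) : ℝ) *
          (((if (pp : ℕ) = 2 then 2 else 1 : ℕ) : ℝ) - logRadiusA pp (absRamificationIdx (pp : ℕ) (kOf (pilotDataOfK D K) pp.1 w)))) :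
    haveI : Fact (pp : ℕ).Prime := ⟨pp.2⟩
    tq pp w ∈ tq pp w ^ (j ^ 2) • logShell (PadicLogOnUnits.ofUnitLog (pp : ℕ) (kOf (pilotDataOfK D K) pp.1 w)) := by
  haveI hF : Fact (pp : ℕ).Prime := ⟨pp.2⟩
  have he : (0 : ℝ) < (absRamificationIdx (pp : ℕ) (kOf (pilotDataOfK D K) pp.1 w) : ℝ) := by
    exact_mod_cast absRamificationIdx_pos (pp : ℕ) (kOf (pilotDataOfK D K) pp.1 w)
  refine mem_pow_smul_logShell_of_height_le (pp : ℕ) (kOf (pilotDataOfK D K) pp.1 w) (htq0 pp w)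
    (norm_tq_eq_rpow D tq htq0 htq pp w hP) ?_
  rw [← mul_div_assoc, div_le_iff₀ he]
  linarith

include htq0 htq in
/-- **NEG CELL, real height form** (any stratum): `e_w·(b_{e_w} + c) < ((j²) − 1)·P_w` ⟹ `t_{q,w} ∉ t_{q,w}^{j²} · ℐ_{K_w}` (abc-iut-rp-d2's
`height_le_of_mem_pow_smul_logShell`). [cite: MochizukiAbsTopIII2015, Def 5.4 (iii) p. 126] [claim: Mochizuki2012, status: disputed] -/
theorem not_cell_of_lt (pp : Nat.Primes) (w : (thetaIndex (pilotDataOfK D K)).Fibre (.inr pp)) {P : ℕ}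
    (hP : haveI : Fact (pp : ℕ).Prime := ⟨pp.2⟩; (pilotDataOfK D K).qPilot (placeOf (pilotDataOfK D K) pp.1 w) = P) {j : ℕ}
    (hlt : haveI : Fact (pp : ℕ).Prime := ⟨pp.2⟩
      (absRamificationIdx (pp : ℕ) (kOf (pilotDataOfK D K) pp.1 w) : ℝ) *
          (logRadiusB pp (absRamificationIdx (pp : ℕ) (kOf (pilotDataOfK D K) pp.1 w)) + ((if (pp : ℕ) = 2 then 2 else 1 : ℕ) : ℝ)) <
        (((j ^ 2 : ℕ) : ℝ) - 1) * (P : ℝ)) :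
    haveI : Fact (pp : ℕ).Prime := ⟨pp.2⟩
    tq pp w ∉ tq pp w ^ (j ^ 2) • logShell (PadicLogOnUnits.ofUnitLog (pp : ℕ) (kOf (pilotDataOfK D K) pp.1 w)) := by
  haveI hF : Fact (pp : ℕ).Prime := ⟨pp.2⟩
  intro hmem
  have he : (0 : ℝ) < (absRamificationIdx (pp : ℕ) (kOf (pilotDataOfK D K) pp.1 w) : ℝ) := by
    exact_mod_cast absRamificationIdx_pos (pp : ℕ) (kOf (pilotDataOfK D K) pp.1 w)
  have h := height_le_of_mem_pow_smul_logShell (pp : ℕ) (kOf (pilotDataOfK D K) pp.1 w) (norm_tq_eq_rpow D tq htq0 htq pp w hP) hmem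
  rw [← mul_div_assoc, div_le_iff₀ he] at h
  linarith

include htq0 htq in
/-- **POS CELL FROM THE INTEGER POS DOOR** (odd `p`): `PosDoor p e_w P_w j` ⟹ `t_{q,w} ∈ t_{q,w}^{j²} · ℐ_{K_w}` — with abc-iut-rp-x2's
`logRadiusA_eq_ceilDiv` (`e·a_e = ⌈e/(p−2)⌉ = (e + p − 3)/(p − 2)`). This is the I06STAR-COLUMNS POS recipe «`h ≤ κ⁻`» instantiated at the row.
[cite: Mochizuki2012, IUTchIV Prop. 1.2 (i) p. 10] [cite: MochizukiAbsTopIII2015, Def 5.4 (iii) p. 126] [claim: Mochizuki2012, status: disputed] -/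
theorem cell_of_posDoor (pp : Nat.Primes) (w : (thetaIndex (pilotDataOfK D K)).Fibre (.inr pp)) (hp2 : (pp : ℕ) ≠ 2) {P : ℕ}
    (hP : haveI : Fact (pp : ℕ).Prime := ⟨pp.2⟩; (pilotDataOfK D K).qPilot (placeOf (pilotDataOfK D K) pp.1 w) = P) {e : ℕ}
    (he : haveI : Fact (pp : ℕ).Prime := ⟨pp.2⟩; absRamificationIdx (pp : ℕ) (kOf (pilotDataOfK D K) pp.1 w) = e) {j : ℕ}
    (hdoor : PosDoor (pp : ℕ) e P j) :
    haveI : Fact (pp : ℕ).Prime := ⟨pp.2⟩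
    tq pp w ∈ tq pp w ^ (j ^ 2) • logShell (PadicLogOnUnits.ofUnitLog (pp : ℕ) (kOf (pilotDataOfK D K) pp.1 w)) := by
  haveI hF : Fact (pp : ℕ).Prime := ⟨pp.2⟩
  have hp3 : 2 < (pp : ℕ) := lt_of_le_of_ne pp.2.two_le (Ne.symm hp2)
  have he1 : 1 ≤ e := he ▸ absRamificationIdx_pos (pp : ℕ) (kOf (pilotDataOfK D K) pp.1 w)
  apply cell_of_le D tq htq0 htq pp w hP
  rw [he, if_neg hp2, logRadiusA_eq_ceilDiv hp3 he1]
  unfold PosDoor at hdoor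
  generalize (e + ((pp : ℕ) - 3)) / ((pp : ℕ) - 2) = A at hdoor ⊢
  have hA : ((j ^ 2 * P + A : ℕ) : ℝ) ≤ ((e + P : ℕ) : ℝ) := by exact_mod_cast hdoor
  have he0 : (0 : ℝ) < (e : ℝ) := by exact_mod_cast he1
  have key : (e : ℝ) * (((1 : ℕ) : ℝ) - (A : ℝ) / (e : ℝ)) = (e : ℝ) - (A : ℝ) := by
    rw [Nat.cast_one, mul_sub, mul_one, mul_div_cancel₀ (A : ℝ) he0.ne']
  rw [key]
  push_cast at hA ⊢
  linarith

include htq0 htq in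
/-- **NEG CELL FROM THE INTEGER NEG DOOR** (odd `p`, row `e_w ≥ p − 1`): `NegDoor p e_w P_w j` ⟹ `t_{q,w} ∉ t_{q,w}^{j²} · ℐ_{K_w}` — with abc-iut-rp-x2's
`logRadiusB_eq_natLog` (`e·(b_e + 1) = e·(⌊log_p(e/(p−1))⌋ + 2) − 1`). The I06STAR-COLUMNS NEG recipe «`h > κ⁺`» at a deep/boundary row.
[cite: Mochizuki2012, IUTchIV Prop. 1.2 (i) p. 10] [cite: MochizukiAbsTopIII2015, Def 5.4 (iii) p. 126] [claim: Mochizuki2012, status: disputed] -/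
theorem not_cell_of_negDoor (pp : Nat.Primes) (w : (thetaIndex (pilotDataOfK D K)).Fibre (.inr pp)) (hp2 : (pp : ℕ) ≠ 2) {P : ℕ}
    (hP : haveI : Fact (pp : ℕ).Prime := ⟨pp.2⟩; (pilotDataOfK D K).qPilot (placeOf (pilotDataOfK D K) pp.1 w) = P) {e : ℕ}
    (he : haveI : Fact (pp : ℕ).Prime := ⟨pp.2⟩; absRamificationIdx (pp : ℕ) (kOf (pilotDataOfK D K) pp.1 w) = e)
    (hpe : (pp : ℕ) - 1 ≤ e) {j : ℕ} (hdoor : NegDoor (pp : ℕ) e P j) :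
    haveI : Fact (pp : ℕ).Prime := ⟨pp.2⟩
    tq pp w ∉ tq pp w ^ (j ^ 2) • logShell (PadicLogOnUnits.ofUnitLog (pp : ℕ) (kOf (pilotDataOfK D K) pp.1 w)) := by
  haveI hF : Fact (pp : ℕ).Prime := ⟨pp.2⟩
  have he1 : 1 ≤ e := he ▸ absRamificationIdx_pos (pp : ℕ) (kOf (pilotDataOfK D K) pp.1 w)
  apply not_cell_of_lt D tq htq0 htq pp w hP
  rw [he, if_neg hp2, logRadiusB_eq_natLog pp.2.one_lt hpe]
  unfold NegDoor at hdoor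
  generalize Nat.log (pp : ℕ) (e / ((pp : ℕ) - 1)) = L at hdoor ⊢
  have hA : ((e * (L + 2) + P : ℕ) : ℝ) ≤ ((j ^ 2 * P : ℕ) : ℝ) := by exact_mod_cast hdoor
  have he0 : (0 : ℝ) < (e : ℝ) := by exact_mod_cast he1
  have key : (e : ℝ) * (((L + 1 : ℕ) : ℝ) - 1 / (e : ℝ) + ((1 : ℕ) : ℝ)) = (e : ℝ) * ((L : ℝ) + 2) - 1 := by
    field_simp
    push_cast
    ring
  rw [key]
  push_cast at hA ⊢
  linarith

include htq0 htq in
/-- **TAME CELL, CLOSED FORM** (`p > 2`, `e_w ≤ p − 2`), BY NAME abc-iut-w5-d068's `mem_pow_smul_logShell_qIdele_pilotDataOfK_iff_of_tame`: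
`t_{q,w} ∈ t_{q,w}^{j²} · ℐ_{K_w} ⟺ ((j²) − 1)·P_w ≤ e_w − 1`. [cite: DupuyHilado2025, §3.4] [cite: MochizukiAbsTopIII2015, Def 5.4 (iii) p. 126]
[claim: Mochizuki2012, status: disputed] -/
theorem cell_iff_of_tame (pp : Nat.Primes) (w : (thetaIndex (pilotDataOfK D K)).Fibre (.inr pp)) (hp3 : 2 < (pp : ℕ)) {e : ℕ}
    (hep : e ≤ (pp : ℕ) - 2)
    (hram : haveI : Fact (pp : ℕ).Prime := ⟨pp.2⟩; (placeOf (pilotDataOfK D K) pp.1 w).asIdeal.ramificationIdx ℤ = e) {P : ℕ}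
    (hP : haveI : Fact (pp : ℕ).Prime := ⟨pp.2⟩; (pilotDataOfK D K).qPilot (placeOf (pilotDataOfK D K) pp.1 w) = P) (j : ℕ) :
    haveI : Fact (pp : ℕ).Prime := ⟨pp.2⟩
    tq pp w ∈ tq pp w ^ (j ^ 2) • logShell (PadicLogOnUnits.ofUnitLog (pp : ℕ) (kOf (pilotDataOfK D K) pp.1 w)) ↔
      (((j ^ 2 : ℕ) : ℤ) - 1) * (P : ℤ) ≤ (e : ℤ) - 1 :=
  CandInternal2RealLabelsLicenceGenuineK.mem_pow_smul_logShell_qIdele_pilotDataOfK_iff_of_tame D tq htq0 htq pp w hp3 hep hram hP (j ^ 2)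

include htq0 htq in
/-- **k1 POS VERDICT FOR `H⋆_9`**: if at EVERY bad place `w ∣ p` of the genuine datum the integer POS door holds at the label `3` for the
(integral) q-degree `P_w` and `e_w = e(K_w/ℚ_p)` — the row's «`h(w,3) = 8H/(2l) ≤ kappa_minus(w)`» — then `H⋆_9` holds (labels `j ≤ 3` by
antitonicity of the door; `p` is odd at bad places by [IUTchI] Def. 3.1 (b), abc-iut-w5-d054's `ne_two_and_ne_l_of_placeOf_mem_S_pilotDataOfK`).
[cite: Mochizuki2012, IUTchI Def. 3.1 (b) p. 61, Ex. 3.2 (iv) p. 71; IUTchIV Prop. 1.2 (i) p. 10] [claim: Mochizuki2012, status: disputed] -/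
theorem hStar_of_posDoor
    (hdoor : ∀ (pp : Nat.Primes) (w : (thetaIndex (pilotDataOfK D K)).Fibre (.inr pp)),
      haveI : Fact (pp : ℕ).Prime := ⟨pp.2⟩
      placeOf (pilotDataOfK D K) pp.1 w ∈ (pilotDataOfK D K).S →
        ∃ P : ℕ, (pilotDataOfK D K).qPilot (placeOf (pilotDataOfK D K) pp.1 w) = P ∧
          PosDoor (pp : ℕ) (absRamificationIdx (pp : ℕ) (kOf (pilotDataOfK D K) pp.1 w)) P 3) :
    HStar D tq := by
  intro pp i w hw hi
  haveI hF : Fact (pp : ℕ).Prime := ⟨pp.2⟩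
  obtain ⟨P, hP, hd⟩ := hdoor pp w hw
  have hp2 : (pp : ℕ) ≠ 2 := (ne_two_and_ne_l_of_placeOf_mem_S_pilotDataOfK D pp w hw).1
  exact cell_of_posDoor D tq htq0 htq pp w hp2 hP rfl (posDoor_anti hi hd)

include htq0 htq in
/-- **k1 NEG VERDICT FOR `H⋆_9`**: for `l ≥ 7` (so that `3 ∈ 𝔽_l^⋇`), if at ONE bad place `w ∣ p` with `e_w ≥ p − 1` the integer NEG door holds at
the label `3`, then `H⋆_9` FAILS at the genuine datum. [cite: Mochizuki2012, IUTchI Def. 3.1 (b) p. 61, Ex. 3.2 (iv) p. 71; IUTchIV Prop. 1.2 (i) p. 10]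
[claim: Mochizuki2012, status: disputed] -/
theorem not_hStar_of_negDoor (hl : 7 ≤ l) (pp : Nat.Primes) (w : (thetaIndex (pilotDataOfK D K)).Fibre (.inr pp))
    (hw : haveI : Fact (pp : ℕ).Prime := ⟨pp.2⟩; placeOf (pilotDataOfK D K) pp.1 w ∈ (pilotDataOfK D K).S) {P : ℕ}
    (hP : haveI : Fact (pp : ℕ).Prime := ⟨pp.2⟩; (pilotDataOfK D K).qPilot (placeOf (pilotDataOfK D K) pp.1 w) = P)
    (hpe : haveI : Fact (pp : ℕ).Prime := ⟨pp.2⟩; (pp : ℕ) - 1 ≤ absRamificationIdx (pp : ℕ) (kOf (pilotDataOfK D K) pp.1 w))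
    (hdoor : haveI : Fact (pp : ℕ).Prime := ⟨pp.2⟩; NegDoor (pp : ℕ) (absRamificationIdx (pp : ℕ) (kOf (pilotDataOfK D K) pp.1 w)) P 3) :
    ¬ HStar D tq := by
  haveI hF : Fact (pp : ℕ).Prime := ⟨pp.2⟩
  intro h
  have hp2 : (pp : ℕ) ≠ 2 := (ne_two_and_ne_l_of_placeOf_mem_S_pilotDataOfK D pp w hw).1
  have h3 : 2 < (pilotDataOfK D K).lstar := by rw [lstar_eq]; omega
  have hcell := h pp ⟨2, h3⟩ w hw le_rfl
  exact not_cell_of_negDoor D tq htq0 htq pp w hp2 hP rfl hpe hdoor hcell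

omit tq in
/-- **`H⋆_9` AT THE CHOSEN REALISING q-IDELE, idele-hypothesis-free** (abc-iut-rp-cx pattern; `Cor312Prov.exists_realising_qIdeles_pilotDataOfK`,
[IUTchI] Ex. 3.2 (iv)): the POS door at `j = 3` at every bad place ⟹ `H⋆_9` for THE chosen q-idele of the `K`-level certificates.
[cite: Mochizuki2012, IUTchI Ex. 3.2 (iv) p. 71] [claim: Mochizuki2012, status: disputed] -/
theorem hStar_chosen_of_posDoor
    (hdoor : ∀ (pp : Nat.Primes) (w : (thetaIndex (pilotDataOfK D K)).Fibre (.inr pp)),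
      haveI : Fact (pp : ℕ).Prime := ⟨pp.2⟩
      placeOf (pilotDataOfK D K) pp.1 w ∈ (pilotDataOfK D K).S →
        ∃ P : ℕ, (pilotDataOfK D K).qPilot (placeOf (pilotDataOfK D K) pp.1 w) = P ∧
          PosDoor (pp : ℕ) (absRamificationIdx (pp : ℕ) (kOf (pilotDataOfK D K) pp.1 w)) P 3) :
    HStar D (exists_realising_qIdeles_pilotDataOfK D).choose :=
  hStar_of_posDoor D (exists_realising_qIdeles_pilotDataOfK D).choose (exists_realising_qIdeles_pilotDataOfK D).choose_spec.1
    (exists_realising_qIdeles_pilotDataOfK D).choose_spec.2.2 hdoor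

end Genuine

/-! ## §4. k1 rows in column vocabulary, by `decide` (`P_w = m_q(w) = e_w·H/(2l)`; HEX: `p = 7`, `e_w = l·e(v|7)`, `P_w = k·e(v|7)`) -/

/-- **THE HEX FRONTIER OF ROW 9** (G-HEX λ_k family, `p = 7`, `H = 2k`, `e_w = l·e(v|7)`, `P_w = k·e(v|7)`): at `j = 3` the POS door HOLDS at
`k = 1` for every tabulated local type over `l = 11, 13` (TIGHT at `(k,l,e_w) = (1,11,11)`: `8·1 + ⌈11/5⌉ = 11 = e_w`), and at `k = 2` NEITHER door
holds (OPEN) — the table's «16/256 = the k = 1 groups; OPEN 240». [folklore] -/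
theorem k1_hex_frontier :
    PosDoor 7 11 1 3 ∧ PosDoor 7 22 2 3 ∧ PosDoor 7 33 3 3 ∧ PosDoor 7 55 5 3 ∧ PosDoor 7 66 6 3 ∧ PosDoor 7 110 10 3 ∧
      PosDoor 7 165 15 3 ∧ PosDoor 7 330 30 3 ∧
    PosDoor 7 13 1 3 ∧ PosDoor 7 26 2 3 ∧ PosDoor 7 39 3 3 ∧ PosDoor 7 65 5 3 ∧ PosDoor 7 78 6 3 ∧ PosDoor 7 130 10 3 ∧
      PosDoor 7 195 15 3 ∧ PosDoor 7 390 30 3 ∧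
    ¬ PosDoor 7 11 2 3 ∧ ¬ NegDoor 7 11 2 3 ∧ ¬ PosDoor 7 330 60 3 ∧ ¬ NegDoor 7 330 60 3 ∧
    ¬ PosDoor 7 13 2 3 ∧ ¬ NegDoor 7 13 2 3 ∧ ¬ PosDoor 7 390 60 3 ∧ ¬ NegDoor 7 390 60 3 := by
  unfold PosDoor NegDoor
  decide

/-- **Large `k` on HEX is NEG already at `j = 3`** (e.g. `(k,l) = (16,11)`, `e_w = 11`, `P_w = 16`: `11·2 + 16 ≤ 144`; `k = 6` at `e_w = l`),
consistent with the table's label profiles «1;2» / «1;3» there, while `(k,l,e_w) = (3,13,13)` is OPEN at `j = 3`. [folklore] -/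
theorem k1_hex_large_k :
    NegDoor 7 11 16 3 ∧ NegDoor 7 13 16 3 ∧ NegDoor 7 11 6 3 ∧ NegDoor 7 13 6 3 ∧ ¬ NegDoor 7 13 3 3 ∧ ¬ PosDoor 7 13 3 3 := by
  unfold PosDoor NegDoor
  decide

/-- **THE CONCRETE / DH ROWS at `j = min(3, l⋆)`**: DH11a1 (`p = 11`, `e_w = 78`, `H = 5`, `l = 13`, `P_w = 15`) OPEN at `j = 3`; DH67a1
(`p = 67`, `e_w = 210`, `H = 1`, `l = 7`, `P_w = 15`) POS at `j = 3`; S-X75 (`p = 7`, `e_w = 5`, `H = 2`, `l = 5`, `P_w = 1`) POS at its top label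
`2`; S-X72 (`p = 7`, `e_w = 2`, `H = 5`, `l = 5`, `P_w = 1`) not POS at `2` (tame NEG: `(2²−1)·1 > e_w − 1`). [folklore] -/
theorem k1_concrete_rows :
    ¬ PosDoor 11 78 15 3 ∧ ¬ NegDoor 11 78 15 3 ∧ PosDoor 67 210 15 3 ∧ PosDoor 7 5 1 2 ∧ ¬ PosDoor 7 2 1 2 := by
  unfold PosDoor NegDoor
  decide

end Summit.ABC.IUTFork.Repair.RH.LabelCutJ3

end
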